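import Summits.CriticalPhenomena.PercolationContinuityZ3.Theorems.Transplant.FKConnectivityAllQPat3ShapeZeroK
import Summits.CriticalPhenomena.PercolationContinuityZ3.Theorems.Transplant.FKConnectivityAllQPat3EeeKTriFreeTsymB
import Summits.CriticalPhenomena.PercolationContinuityZ3.Theorems.Transplant.FKConnectivityAllQPat3EeeKTriFreeStarXB6
import Summits.CriticalPhenomena.PercolationContinuityZ3.Theorems.Transplant.FKConnectivityAllQPat3EeeKTriFreeStarXmB6
import Summits.CriticalPhenomena.PercolationContinuityZ3.Theorems.Transplant.FKConnectivityAllQPat3EeeKTriFreeStarSB6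
import Summits.CriticalPhenomena.PercolationContinuityZ3.Theorems.Transplant.FKConnectivityAllQPat3EeeKTriCdTsymB
import Summits.CriticalPhenomena.PercolationContinuityZ3.Theorems.Transplant.FKConnectivityAllQPat3EeeKTriCdStarXB
import Summits.CriticalPhenomena.PercolationContinuityZ3.Theorems.Transplant.FKConnectivityAllQPat3EeeKTriCdStarXmB
import Summits.CriticalPhenomena.PercolationContinuityZ3.Theorems.Transplant.FKConnectivityAllQPat3EeeKTriCdStarSB
import Summits.CriticalPhenomena.PercolationContinuityZ3.Theorems.Transplant.FKConnectivityAllQPat3EeeKTriBdTsymB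
import Summits.CriticalPhenomena.PercolationContinuityZ3.Theorems.Transplant.FKConnectivityAllQPat3EeeKTriBdStarXB
import Summits.CriticalPhenomena.PercolationContinuityZ3.Theorems.Transplant.FKConnectivityAllQPat3EeeKTriBdStarXmB
import Summits.CriticalPhenomena.PercolationContinuityZ3.Theorems.Transplant.FKConnectivityAllQPat3EeeKTriBdStarSB
import Summits.CriticalPhenomena.PercolationContinuityZ3.Theorems.Transplant.FKConnectivityAllQPat3EeeKTriBdcdTsymB
import Summits.CriticalPhenomena.PercolationContinuityZ3.Theorems.Transplant.FKConnectivityAllQPat3EeeKTriBdcdStarXB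
import Summits.CriticalPhenomena.PercolationContinuityZ3.Theorems.Transplant.FKConnectivityAllQPat3EeeKTriBdcdStarXmB
import Summits.CriticalPhenomena.PercolationContinuityZ3.Theorems.Transplant.FKConnectivityAllQPat3EeeKTriBdcdStarSB
import Summits.CriticalPhenomena.PercolationContinuityZ3.Theorems.Transplant.FKConnectivityAllQPat3EeeKTriAdTsymB
import Summits.CriticalPhenomena.PercolationContinuityZ3.Theorems.Transplant.FKConnectivityAllQPat3EeeKTriAdStarXB
import Summits.CriticalPhenomena.PercolationContinuityZ3.Theorems.Transplant.FKConnectivityAllQPat3EeeKTriAdStarXmB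
import Summits.CriticalPhenomena.PercolationContinuityZ3.Theorems.Transplant.FKConnectivityAllQPat3EeeKTriAdStarSB
import Summits.CriticalPhenomena.PercolationContinuityZ3.Theorems.Transplant.FKConnectivityAllQPat3EeeKTriAdcdTsymB
import Summits.CriticalPhenomena.PercolationContinuityZ3.Theorems.Transplant.FKConnectivityAllQPat3EeeKTriAdcdStarXB
import Summits.CriticalPhenomena.PercolationContinuityZ3.Theorems.Transplant.FKConnectivityAllQPat3EeeKTriAdcdStarXmB
import Summits.CriticalPhenomena.PercolationContinuityZ3.Theorems.Transplant.FKConnectivityAllQPat3EeeKTriAdcdStarSB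
import Summits.CriticalPhenomena.PercolationContinuityZ3.Theorems.Transplant.FKConnectivityAllQPat3EeeKTriAdbdTsymB
import Summits.CriticalPhenomena.PercolationContinuityZ3.Theorems.Transplant.FKConnectivityAllQPat3EeeKTriAdbdStarXB
import Summits.CriticalPhenomena.PercolationContinuityZ3.Theorems.Transplant.FKConnectivityAllQPat3EeeKTriAdbdStarXmB
import Summits.CriticalPhenomena.PercolationContinuityZ3.Theorems.Transplant.FKConnectivityAllQPat3EeeKTriAdbdStarSB
import Summits.CriticalPhenomena.PercolationContinuityZ3.Theorems.Transplant.FKConnectivityAllQPat3EeeKTriAdbdcdTsymB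
import Summits.CriticalPhenomena.PercolationContinuityZ3.Theorems.Transplant.FKConnectivityAllQPat3EeeKTriAdbdcdStarXB
import Summits.CriticalPhenomena.PercolationContinuityZ3.Theorems.Transplant.FKConnectivityAllQPat3EeeKTriAdbdcdStarXmB
import Summits.CriticalPhenomena.PercolationContinuityZ3.Theorems.Transplant.FKConnectivityAllQPat3EeeKTriAdbdcdStarSB
import HarnessLib

/-!
# Connectivity correlation inequalities for `φ_{w,q}`, every `q > 0` — THE LEAF EEEtri IN ALL EIGHT K-STATES: the row facts bundled over
# the splits of `[(0, 3), (1, 3), (2, 3)]` (census g41)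

Proof file (`--supports stmt-CriticalPhenomena-4575`), census lineage (gen 41) of LANE 2's FK sub-programme; builds on p205010 (kernel
theorem, internal audit signed; external expert review pending).  No definitions, no named facts, no sorries; standard axioms.

Collects the closing `_rows` theorems of the 32 data file groups `…Pat3EeeKTri<State><Target>…` (8 states × 4 targets; census g41's prepared
set, kit j242142 certificates, `coefTab3K`) into four statements quantified over the state (L, K) of the three plain slots:
`FK.eeeKtri_tsym_rows / _starX_rows / _starXm_rows / _starS_rows` — the form the K-state leaf lemmas `…Pat3EeeLeafK` consume.
[cite: AyyerLinussonRavichandran2025, §7 (p. 22)]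
-/

namespace Summit.CriticalPhenomena.PercolationContinuityZ3.Theorems

namespace FK

/-- The 8 ordered splits of the plain slots `[(0, 3), (1, 3), (2, 3)]` into (free, contracted), in the order `FK.splits` lists them. [folklore] -/
theorem splits_eeetriSkelK : splits ([(0, 3), (1, 3), (2, 3)] : List (Fin 7 × Fin 7)) =
    [([(0, 3), (1, 3), (2, 3)], []),
     ([(0, 3), (1, 3)], [(2, 3)]),
     ([(0, 3), (2, 3)], [(1, 3)]),
     ([(0, 3)], [(1, 3), (2, 3)]),
     ([(1, 3), (2, 3)], [(0, 3)]),
     ([(1, 3)], [(0, 3), (2, 3)]),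
     ([(2, 3)], [(0, 3), (1, 3)]),
     ([], [(0, 3), (1, 3), (2, 3)])] := by
  decide

/-- **EEEtri rows in every K-state, target `tsym2Tab`** (kernel-checked certificates of the 8 data file groups). [cite: AyyerLinussonRavichandran2025, §7 (p. 22)] -/
theorem eeeKtri_tsym_rows : ∀ LK ∈ splits ([(0, 3), (1, 3), (2, 3)] : List (Fin 7 × Fin 7)), ∃ prods : List Prod3, ∃ Dn : ℕ, 0 < Dn ∧
    (∃ cs : List (ℕ × ℕ × ℕ × ℕ × ℕ), prods = cs.map (Prod3.ofIdx famP11orb)) ∧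
    ∀ (d : ℕ) (PK QK P1 Q1 P2 Q2 : Pat3), 8 * (prods.map fun q => (q.lam : ℤ) * q.tensor d PK QK P1 Q1 P2 Q2).sum ≤
      (Dn : ℤ) * symm8d (coefTab3K LK.1 LK.2 (0 : Fin 7) 1 4 1 2 5 2 0 6 4 5 6 tsym2Tab) d PK QK P1 Q1 P2 Q2 := by
  intro LK hLK
  rw [splits_eeetriSkelK] at hLK
  fin_cases hLK

  · exact ⟨eeeKtrifree_tsymProds, 291968000, by decide, ⟨_, rfl⟩, eeeKtrifree_tsym_rows⟩
  · exact ⟨eeeKtricd_tsymProds, 75706091136, by decide, ⟨_, rfl⟩, eeeKtricd_tsym_rows⟩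
  · exact ⟨eeeKtribd_tsymProds, 537121538304, by decide, ⟨_, rfl⟩, eeeKtribd_tsym_rows⟩
  · exact ⟨eeeKtribdcd_tsymProds, 8, by decide, ⟨_, rfl⟩, eeeKtribdcd_tsym_rows⟩
  · exact ⟨eeeKtriad_tsymProds, 92306388096, by decide, ⟨_, rfl⟩, eeeKtriad_tsym_rows⟩
  · exact ⟨eeeKtriadcd_tsymProds, 8, by decide, ⟨_, rfl⟩, eeeKtriadcd_tsym_rows⟩
  · exact ⟨eeeKtriadbd_tsymProds, 8, by decide, ⟨_, rfl⟩, eeeKtriadbd_tsym_rows⟩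
  · exact ⟨eeeKtriadbdcd_tsymProds, 1, by decide, ⟨_, rfl⟩, eeeKtriadbdcd_tsym_rows⟩

/-- **EEEtri rows in every K-state, target `starXTab`** (kernel-checked certificates of the 8 data file groups). [cite: AyyerLinussonRavichandran2025, §7 (p. 22)] -/
theorem eeeKtri_starX_rows : ∀ LK ∈ splits ([(0, 3), (1, 3), (2, 3)] : List (Fin 7 × Fin 7)), ∃ prods : List Prod3, ∃ Dn : ℕ, 0 < Dn ∧
    (∃ cs : List (ℕ × ℕ × ℕ × ℕ × ℕ), prods = cs.map (Prod3.ofIdx famP11orb)) ∧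
    ∀ (d : ℕ) (PK QK P1 Q1 P2 Q2 : Pat3), 8 * (prods.map fun q => (q.lam : ℤ) * q.tensor d PK QK P1 Q1 P2 Q2).sum ≤
      (Dn : ℤ) * symm8d (coefTab3K LK.1 LK.2 (0 : Fin 7) 1 4 1 2 5 2 0 6 4 5 6 starXTab) d PK QK P1 Q1 P2 Q2 := by
  intro LK hLK
  rw [splits_eeetriSkelK] at hLK
  fin_cases hLK

  · exact ⟨eeeKtrifree_starXProds, 82385060450322801383493120, by decide, ⟨_, rfl⟩, eeeKtrifree_starX_rows⟩
  · exact ⟨eeeKtricd_starXProds, 626698368, by decide, ⟨_, rfl⟩, eeeKtricd_starX_rows⟩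
  · exact ⟨eeeKtribd_starXProds, 640008765984, by decide, ⟨_, rfl⟩, eeeKtribd_starX_rows⟩
  · exact ⟨eeeKtribdcd_starXProds, 8, by decide, ⟨_, rfl⟩, eeeKtribdcd_starX_rows⟩
  · exact ⟨eeeKtriad_starXProds, 640008765984, by decide, ⟨_, rfl⟩, eeeKtriad_starX_rows⟩
  · exact ⟨eeeKtriadcd_starXProds, 8, by decide, ⟨_, rfl⟩, eeeKtriadcd_starX_rows⟩
  · exact ⟨eeeKtriadbd_starXProds, 8, by decide, ⟨_, rfl⟩, eeeKtriadbd_starX_rows⟩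
  · exact ⟨eeeKtriadbdcd_starXProds, 1, by decide, ⟨_, rfl⟩, eeeKtriadbdcd_starX_rows⟩

/-- **EEEtri rows in every K-state, target `mirror2 starXTab`** (kernel-checked certificates of the 8 data file groups). [cite: AyyerLinussonRavichandran2025, §7 (p. 22)] -/
theorem eeeKtri_starXm_rows : ∀ LK ∈ splits ([(0, 3), (1, 3), (2, 3)] : List (Fin 7 × Fin 7)), ∃ prods : List Prod3, ∃ Dn : ℕ, 0 < Dn ∧
    (∃ cs : List (ℕ × ℕ × ℕ × ℕ × ℕ), prods = cs.map (Prod3.ofIdx famP11orb)) ∧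
    ∀ (d : ℕ) (PK QK P1 Q1 P2 Q2 : Pat3), 8 * (prods.map fun q => (q.lam : ℤ) * q.tensor d PK QK P1 Q1 P2 Q2).sum ≤
      (Dn : ℤ) * symm8d (coefTab3K LK.1 LK.2 (0 : Fin 7) 1 4 1 2 5 2 0 6 4 5 6 (mirror2 starXTab)) d PK QK P1 Q1 P2 Q2 := by
  intro LK hLK
  rw [splits_eeetriSkelK] at hLK
  fin_cases hLK

  · exact ⟨eeeKtrifree_starXmProds, 2761301948663216993771520, by decide, ⟨_, rfl⟩, eeeKtrifree_starXm_rows⟩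
  · exact ⟨eeeKtricd_starXmProds, 640008765984, by decide, ⟨_, rfl⟩, eeeKtricd_starXm_rows⟩
  · exact ⟨eeeKtribd_starXmProds, 640008765984, by decide, ⟨_, rfl⟩, eeeKtribd_starXm_rows⟩
  · exact ⟨eeeKtribdcd_starXmProds, 8, by decide, ⟨_, rfl⟩, eeeKtribdcd_starXm_rows⟩
  · exact ⟨eeeKtriad_starXmProds, 6759612121200, by decide, ⟨_, rfl⟩, eeeKtriad_starXm_rows⟩
  · exact ⟨eeeKtriadcd_starXmProds, 8, by decide, ⟨_, rfl⟩, eeeKtriadcd_starXm_rows⟩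
  · exact ⟨eeeKtriadbd_starXmProds, 8, by decide, ⟨_, rfl⟩, eeeKtriadbd_starXm_rows⟩
  · exact ⟨eeeKtriadbdcd_starXmProds, 1, by decide, ⟨_, rfl⟩, eeeKtriadbdcd_starXm_rows⟩

/-- **EEEtri rows in every K-state, target `starSTab`** (kernel-checked certificates of the 8 data file groups). [cite: AyyerLinussonRavichandran2025, §7 (p. 22)] -/
theorem eeeKtri_starS_rows : ∀ LK ∈ splits ([(0, 3), (1, 3), (2, 3)] : List (Fin 7 × Fin 7)), ∃ prods : List Prod3, ∃ Dn : ℕ, 0 < Dn ∧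
    (∃ cs : List (ℕ × ℕ × ℕ × ℕ × ℕ), prods = cs.map (Prod3.ofIdx famP11orb)) ∧
    ∀ (d : ℕ) (PK QK P1 Q1 P2 Q2 : Pat3), 8 * (prods.map fun q => (q.lam : ℤ) * q.tensor d PK QK P1 Q1 P2 Q2).sum ≤
      (Dn : ℤ) * symm8d (coefTab3K LK.1 LK.2 (0 : Fin 7) 1 4 1 2 5 2 0 6 4 5 6 starSTab) d PK QK P1 Q1 P2 Q2 := by
  intro LK hLK
  rw [splits_eeetriSkelK] at hLK
  fin_cases hLK

  · exact ⟨eeeKtrifree_starSProds, 2889772543186690929868800, by decide, ⟨_, rfl⟩, eeeKtrifree_starS_rows⟩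
  · exact ⟨eeeKtricd_starSProds, 640008765984, by decide, ⟨_, rfl⟩, eeeKtricd_starS_rows⟩
  · exact ⟨eeeKtribd_starSProds, 986832064, by decide, ⟨_, rfl⟩, eeeKtribd_starS_rows⟩
  · exact ⟨eeeKtribdcd_starSProds, 8, by decide, ⟨_, rfl⟩, eeeKtribdcd_starS_rows⟩
  · exact ⟨eeeKtriad_starSProds, 640008765984, by decide, ⟨_, rfl⟩, eeeKtriad_starS_rows⟩
  · exact ⟨eeeKtriadcd_starSProds, 8, by decide, ⟨_, rfl⟩, eeeKtriadcd_starS_rows⟩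
  · exact ⟨eeeKtriadbd_starSProds, 8, by decide, ⟨_, rfl⟩, eeeKtriadbd_starS_rows⟩
  · exact ⟨eeeKtriadbdcd_starSProds, 1, by decide, ⟨_, rfl⟩, eeeKtriadbdcd_starS_rows⟩

end FK

end Summit.CriticalPhenomena.PercolationContinuityZ3.Theorems
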